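import Summits.ValiantsHypothesis.ValiantsHypothesis.Theorems.NewtonUnitEquationsTwoProductsTowerRecordCount

/-!
# R13-coeff — LEVEL-FREE LETTER BOUND: the CRAMER RECORD LEMMA; the level-free record law modulo the vertex walk bound

(7/7) K1 without any exchange set (val-idea-37 g4 rev 4 §11; val-idea-crit-8 g2 VERDICT #19 ADDENDUM 2, (T7) word 23:42:56Z): `minorT`, `laplace_relation`
(vanishing `(r+1)`-minors ⇒ Cramer relation `Δ·π_a = Σ_q ± det(swap_q)·π_{β q}`), ★ `cramerRecordLemma` (optimality of the column selection `β*` for the score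
`ξ·x(β) + s·(ξ·d)` is exactly the valued hypothesis of `towerRecordLemma`), ★★ `card_recordLettersAt_le : #recordLettersAt(ξ) ≤ 2m` for EVERY real weight and
ARBITRARY pencils (no degree / level / dissociation hypothesis), `FewLetterSets`, `count_of_fewLetterSets`, the typed PAPER target `VertexWalkBound` (NOT
proved: valuated-matroid shadow + Brualdi exchange + rank potential, memo §8), `LevelFreeRecordLaw`, `arith_levelFree`, ★ `levelFree_of_vertexWalk :
VertexWalkBound → LevelFreeRecordLaw` ((a,b) = (11,1); an honest CONDITIONAL — hypothesis a typed Prop).  §11b (added at transplant): the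
class-side typed targets `LevelFreeCarrierLaw`, `levelFreeCarrier_of_levelFreeRecord` (proved by the degree-`D` Lift in `…TowerRecordLevelFreeCarrier`).
Transplant (val-lit-p3 g18) of val-idea-37 g4's kernel-checked scratch `Cruxes/TwoProducts/TowerRecords_val_idea_37_g4.lean` (rev 4 §11,
sha16 2a92eb1f7d59f466 (§1–§10 = rev 3 988768bd6d8db99a), ns `ValIdea37g4T`; val-idea-crit-8 g2 VERDICT #19 + addendum: KEEP «R13-coeff», by-name GO for a verbatim transplant);
proofs verbatim by name, docstrings added, namespace = the tree's.  Helper on crux `stmt-ValiantsHypothesis-5906` (`TwoProducts`, line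
`relation_ladder`); `--supports`, closes nothing by itself.  HONEST LABEL (crit-8 #19): COEFFICIENT-SIDE; the class rung it feeds (R13, dense
parallel towers on dissociated carriers) is a wider CLASS rung, inert as a hatch; F10's collinear digit towers NOT covered; `ResidualLawV24` ⟺
`PlanarCellBound`, the crux (stmt-5906), every `closes` binder and every summit statement UNMOVED; VP ≠ VNP is NOT proved.
Credit: mathematics and kernel proofs val-idea-37 g4; critic of record val-idea-crit-8 g2.  No instances, no notation, no named facts. [folklore]
-/

set_option linter.dupNamespace false

noncomputable section

open Classical

namespace Summit.ValiantsHypothesis.ValiantsHypothesis.Theorems.NewtonUnitEquations.TwoProducts.TowerRecord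

open scoped BigOperators
open Module Polynomial
open Summit.ValiantsHypothesis.ValiantsHypothesis.Theorems.NewtonUnitEquations.TwoProducts.FormalLogLinearisation
open Summit.ValiantsHypothesis.ValiantsHypothesis.Theorems.NewtonUnitEquations.TwoProducts.MomentRecord
open Summit.ValiantsHypothesis.ValiantsHypothesis.Theorems.NewtonUnitEquations.TwoProducts.PlanarCell

variable {m n : ℕ}

/-! ## 11. LEVEL-FREE (answer to crit-8's Q-R13, coefficient side): the CRAMER RECORD LEMMA

K1 without any exchange set: let `r` be the maximal order of a non-vanishing minor of the pencil matrix `(tvec b)_b` (rows = the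
`2m` factor rows, columns = carriers) and, for a weight `ξ`, let `(ρ, β*, s₀)` MAXIMISE the score `ξ·x(β) + s·(ξ·d)` over all
`r`-column selections `β` with `det Π_{ρ,β} ≠ 0` and `s ∈ supp det Π_{ρ,β}` (the `ξ`-heaviest point of the tower `x(β) + supp(det)·d`).
Laplace expansion of the vanishing `(r+1)`-minors `rows (i,ρ) × cols (a,β*)` gives the Cramer relation
`Δ·π_a = Σ_q ± det Π_{ρ, β*−β*_q+a} · π_{β*_q}`, and optimality of `β*` is EXACTLY the valued hypothesis of K2 (`towerRecordLemma`).
Hence **every record letter at `ξ` is a column of `β*`**: `#letters(ξ) ≤ r ≤ 2m` for EVERY weight — no degree, no level set, no cell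
(`card_recordLettersAt_le`).  The count then needs only the number of distinct optimal column sets met by the sweep `ξ ↦ β*(ξ)`
(`FewLetterSets`; paper proof in the memo: the optimal sets are vertices of a valuated-matroid shadow, consecutive vertices raise the
rank potential `Σ_{b∈β*} #{b'' : η·x_{b''} < η·x_b}` by Brualdi's exchange bijection ⇒ `≤ 4mn + 4` sets) ⇒ `LevelFreeRecordLaw` with `(a,b) = (11,1)`. -/

section Cramer

/-- Minor of the pencil matrix: rows `ρ`, carrier columns `β`. -/
def minorT (γ γ' : Fin m → Fin n → ℂ[X]) {r : ℕ} (ρ : Fin r → Fin m ⊕ Fin m) (β : Fin r → Fin n) : ℂ[X] :=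
  (Matrix.of fun p u => tvec γ γ' (β u) (ρ p)).det

/-- `ξ`-weight of a column selection. -/
def wsum (ξ : Fin 2 → ℝ) (x : Fin n → Expo) {r : ℕ} (β : Fin r → Fin n) : ℝ := ∑ u, wt ξ (x (β u))

/-- Columns `β` with `a` put in front and then position `q` of `β` deleted (Laplace companion). -/
def swapCol {r : ℕ} (β : Fin r → Fin n) (a : Fin n) (q : Fin r) : Fin r → Fin n :=
  fun u => (Fin.cons a β : Fin (r + 1) → Fin n) ((Fin.succ q).succAbove u)

/-- Weight of the Laplace companion selection: `wsum (swap_q) = wsum β − wt(x (β q)) + wt(x a)`. [folklore] -/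
theorem wsum_swapCol (ξ : Fin 2 → ℝ) (x : Fin n → Expo) {r : ℕ} (β : Fin r → Fin n) (a : Fin n) (q : Fin r) :
    wsum ξ x (swapCol β a q) = wsum ξ x β - wt ξ (x (β q)) + wt ξ (x a) := by
  have h := Fin.sum_univ_succAbove (fun v : Fin (r + 1) => wt ξ (x ((Fin.cons a β : Fin (r + 1) → Fin n) v)))
    (Fin.succ q)
  rw [Fin.sum_univ_succ] at h
  simp only [Fin.cons_zero, Fin.cons_succ] at h
  simp only [wsum, swapCol]
  linarith

/-- Laplace: if all `(r+1)`-minors vanish, `Δ·π_a(i) = Σ_q (−1)^q det(swap_q)·π_{β q}(i)`. -/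
theorem laplace_relation (γ γ' : Fin m → Fin n → ℂ[X]) {r : ℕ} (ρ : Fin r → Fin m ⊕ Fin m) (β : Fin r → Fin n)
    (a : Fin n) (i : Fin m ⊕ Fin m)
    (hmax : ∀ (ρ' : Fin (r + 1) → Fin m ⊕ Fin m) (β' : Fin (r + 1) → Fin n), minorT γ γ' ρ' β' = 0) :
    minorT γ γ' ρ β * tvec γ γ' a i
      = ∑ q : Fin r, ((-1) ^ (q : ℕ) * minorT γ γ' ρ (swapCol β a q)) * tvec γ γ' (β q) i := by
  have h0 := hmax (Fin.cons i ρ) (Fin.cons a β)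
  unfold minorT at h0
  rw [Matrix.det_succ_row_zero, Fin.sum_univ_succ] at h0
  have e0 : (Matrix.of fun p u => tvec γ γ' ((Fin.cons a β : Fin (r + 1) → Fin n) u)
      ((Fin.cons i ρ : Fin (r + 1) → Fin m ⊕ Fin m) p)).submatrix Fin.succ (Fin.succAbove (0 : Fin (r + 1)))
      = Matrix.of fun p u => tvec γ γ' (β u) (ρ p) := by
    ext p u
    simp [Matrix.submatrix_apply, Matrix.of_apply, Fin.cons_succ]
  have eq : ∀ q : Fin r, (Matrix.of fun p u => tvec γ γ' ((Fin.cons a β : Fin (r + 1) → Fin n) u)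
      ((Fin.cons i ρ : Fin (r + 1) → Fin m ⊕ Fin m) p)).submatrix Fin.succ (Fin.succAbove (Fin.succ q))
      = Matrix.of fun p u => tvec γ γ' (swapCol β a q u) (ρ p) := by
    intro q
    ext p u
    simp [Matrix.submatrix_apply, Matrix.of_apply, Fin.cons_succ, swapCol]
  simp only [Matrix.of_apply, Fin.cons_zero, Fin.cons_succ, Fin.val_zero, pow_zero, one_mul, Fin.val_succ] at h0
  rw [e0] at h0
  simp only [eq] at h0
  have h1 : tvec γ γ' a i * minorT γ γ' ρ β
      + ∑ q : Fin r, -((-1) ^ (q : ℕ) * minorT γ γ' ρ (swapCol β a q) * tvec γ γ' (β q) i) = 0 := by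
    rw [← h0]
    unfold minorT
    congr 1
    refine Finset.sum_congr rfl fun q _ => ?_
    rw [pow_succ]
    ring
  rw [Finset.sum_neg_distrib] at h1
  have h2 : minorT γ γ' ρ β * tvec γ γ' a i
      = ∑ q : Fin r, (-1) ^ (q : ℕ) * minorT γ γ' ρ (swapCol β a q) * tvec γ γ' (β q) i := by
    linear_combination h1
  rw [h2]

/-- **CRAMER RECORD LEMMA** (level-free K1): a record letter at `ξ` is a column of every `ξ`-optimal maximal minor. -/
theorem cramerRecordLemma (γ γ' : Fin m → Fin n → ℂ[X]) (x : Fin n → Expo) (d : Fin 2 → ℤ) (m' : ℕ)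
    (ξ : Fin 2 → ℝ) (S : Fin n → ℕ) (k : ℕ) (hrec : IsRecordT γ γ' x d m' ξ (S, k)) {r : ℕ}
    (ρ : Fin r → Fin m ⊕ Fin m) (β : Fin r → Fin n) (s₀ : ℕ) (hs₀ : (minorT γ γ' ρ β).coeff s₀ ≠ 0)
    (hmax : ∀ (ρ' : Fin (r + 1) → Fin m ⊕ Fin m) (β' : Fin (r + 1) → Fin n), minorT γ γ' ρ' β' = 0)
    (hopt : ∀ β' : Fin r → Fin n, ∀ s ∈ (minorT γ γ' ρ β').support,
      wsum ξ x β' + (s : ℝ) * wtZ ξ d ≤ wsum ξ x β + (s₀ : ℝ) * wtZ ξ d)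
    (a : Fin n) (hSa : 0 < S a) (ha : ∀ q, β q ≠ a) : False := by
  let Q : Fin n → ℂ[X] := fun b => ∑ q : Fin r, if β q = b then (-1) ^ (q : ℕ) * minorT γ γ' ρ (swapCol β a q) else 0
  have hQa : Q a = 0 := Finset.sum_eq_zero fun q _ => if_neg (ha q)
  have hsum : ∀ g : Fin n → ℂ[X], ∑ b, Q b * g b
      = ∑ q : Fin r, ((-1) ^ (q : ℕ) * minorT γ γ' ρ (swapCol β a q)) * g (β q) := by
    intro g
    simp only [Q, Finset.sum_mul]
    rw [Finset.sum_comm]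
    refine Finset.sum_congr rfl fun q _ => ?_
    rw [Finset.sum_eq_single (β q)]
    · rw [if_pos rfl]
    · intro b _ hb
      rw [if_neg (Ne.symm hb), zero_mul]
    · intro h
      exact absurd (Finset.mem_univ _) h
  have hrel : ∀ j, minorT γ γ' ρ β * γ j a = ∑ b, Q b * γ j b := fun j => by
    rw [hsum]
    exact laplace_relation γ γ' ρ β a (Sum.inl j) hmax
  have hrel' : ∀ j, minorT γ γ' ρ β * γ' j a = ∑ b, Q b * γ' j b := fun j => by
    rw [hsum]
    exact laplace_relation γ γ' ρ β a (Sum.inr j) hmax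
  have hP : ∀ s ∈ (minorT γ γ' ρ β).support, 0 ≤ ((s₀ : ℝ) - s) * wtZ ξ d := by
    intro s hs
    have := hopt β s hs
    have e : ((s₀ : ℝ) - s) * wtZ ξ d = (s₀ : ℝ) * wtZ ξ d - (s : ℝ) * wtZ ξ d := by ring
    linarith
  have hQ : ∀ b, ∀ s ∈ (Q b).support, 0 ≤ wt ξ (x b) - wt ξ (x a) + ((s₀ : ℝ) - s) * wtZ ξ d := by
    intro b s hs
    rw [Polynomial.mem_support_iff] at hs
    simp only [Q, finsetSum_coeff] at hs
    obtain ⟨q, -, hq⟩ := Finset.exists_ne_zero_of_sum_ne_zero hs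
    by_cases hb : β q = b
    · rw [if_pos hb] at hq
      have hs' : s ∈ (minorT γ γ' ρ (swapCol β a q)).support := by
        rw [Polynomial.mem_support_iff]
        intro h0
        apply hq
        rcases neg_one_pow_eq_or ℂ[X] (q : ℕ) with h | h
        · rw [h, one_mul, h0]
        · rw [h, neg_one_mul, coeff_neg, h0, neg_zero]
      have h1 := hopt (swapCol β a q) s hs'
      rw [wsum_swapCol, hb] at h1
      have e : ((s₀ : ℝ) - s) * wtZ ξ d = (s₀ : ℝ) * wtZ ξ d - (s : ℝ) * wtZ ξ d := by ring
      linarith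
    · rw [if_neg hb, coeff_zero] at hq
      exact absurd rfl hq
  exact towerRecordLemma γ γ' x d m' ξ S k hrec a hSa (minorT γ γ' ρ β) Q s₀ hs₀ hQa hrel hrel' hP hQ

/-- The record letters AT ONE WEIGHT `ξ`. -/
def recordLettersAt (γ γ' : Fin m → Fin n → ℂ[X]) (x : Fin n → Expo) (d : Fin 2 → ℤ) (m' : ℕ) (ξ : Fin 2 → ℝ) :
    Finset (Fin n) :=
  Finset.univ.filter fun a => ∃ (S : Fin n → ℕ) (k : ℕ), IsRecordT γ γ' x d m' ξ (S, k) ∧ 0 < S a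

/-- **LEVEL-FREE LETTER BOUND**: for EVERY weight, at most `2m` record letters — arbitrary pencils (any degree, any levels). -/
theorem card_recordLettersAt_le (γ γ' : Fin m → Fin n → ℂ[X]) (x : Fin n → Expo) (d : Fin 2 → ℤ) (m' : ℕ)
    (ξ : Fin 2 → ℝ) : (recordLettersAt γ γ' x d m' ξ).card ≤ 2 * m := by
  -- maximal order `r` of a non-vanishing minor
  let P : ℕ → Prop := fun k => ∀ (ρ : Fin k → Fin m ⊕ Fin m) (β : Fin k → Fin n), minorT γ γ' ρ β = 0
  have hP : P (2 * m + 1) := by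
    intro ρ β
    obtain ⟨p, p', hne, heq⟩ := Fintype.exists_ne_map_eq_of_card_lt ρ (by simp; omega)
    exact Matrix.det_zero_of_row_eq hne (funext fun u => by simp [Matrix.of_apply, heq])
  have hex : ∃ k, P k := ⟨_, hP⟩
  have h0 : ¬ P 0 := by
    intro h
    have := h Fin.elim0 Fin.elim0
    rw [minorT, Matrix.det_fin_zero] at this
    exact one_ne_zero this
  obtain ⟨r, hr⟩ : ∃ r, Nat.find hex = r + 1 :=
    Nat.exists_eq_succ_of_ne_zero (fun h => h0 (h ▸ Nat.find_spec hex))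
  have hmax : P (r + 1) := hr ▸ Nat.find_spec hex
  have hr2 : r ≤ 2 * m := by
    have := Nat.find_le (h := hex) hP
    omega
  have hnot : ¬ P r := Nat.find_min hex (by omega)
  simp only [P, not_forall] at hnot
  obtain ⟨ρ, β₀, hβ₀⟩ := hnot
  -- the `ξ`-optimal column selection
  let T : Finset ((Fin r → Fin n) × ℕ) :=
    (Finset.univ : Finset (Fin r → Fin n)).biUnion fun β' => ((minorT γ γ' ρ β').support).image fun s => (β', s)
  have hmemT : ∀ β' s, (β', s) ∈ T ↔ s ∈ (minorT γ γ' ρ β').support := by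
    intro β' s
    simp only [T, Finset.mem_biUnion, Finset.mem_univ, true_and, Finset.mem_image, Prod.mk.injEq]
    constructor
    · rintro ⟨β'', s', hs', h1, rfl⟩
      rw [← h1]
      exact hs'
    · intro hs
      exact ⟨β', s, hs, rfl, rfl⟩
  have hT : T.Nonempty := by
    obtain ⟨s, hs⟩ := Finset.nonempty_iff_ne_empty.mpr (mt Polynomial.support_eq_empty.mp hβ₀)
    exact ⟨(β₀, s), (hmemT β₀ s).mpr hs⟩
  obtain ⟨⟨β, s₀⟩, hβT, hopt⟩ := Finset.exists_max_image T (fun βs => wsum ξ x βs.1 + (βs.2 : ℝ) * wtZ ξ d) hT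
  have hs₀ : (minorT γ γ' ρ β).coeff s₀ ≠ 0 := Polynomial.mem_support_iff.mp ((hmemT β s₀).mp hβT)
  have hopt' : ∀ β' : Fin r → Fin n, ∀ s ∈ (minorT γ γ' ρ β').support,
      wsum ξ x β' + (s : ℝ) * wtZ ξ d ≤ wsum ξ x β + (s₀ : ℝ) * wtZ ξ d :=
    fun β' s hs => hopt (β', s) ((hmemT β' s).mpr hs)
  -- every record letter is a column of `β`
  have hsub : recordLettersAt γ γ' x d m' ξ ⊆ Finset.univ.image β := by
    intro a ha
    simp only [recordLettersAt, Finset.mem_filter, Finset.mem_univ, true_and] at ha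
    obtain ⟨S, k, hrec, hSa⟩ := ha
    by_contra hna
    have ha' : ∀ q, β q ≠ a := fun q h => hna (Finset.mem_image.mpr ⟨q, Finset.mem_univ _, h⟩)
    exact cramerRecordLemma γ γ' x d m' ξ S k hrec ρ β s₀ hs₀ hmax hopt' a hSa ha'
  calc (recordLettersAt γ γ' x d m' ξ).card ≤ (Finset.univ.image β).card := Finset.card_le_card hsub
    _ ≤ (Finset.univ : Finset (Fin r)).card := Finset.card_image_le
    _ = r := by simp
    _ ≤ 2 * m := hr2

/-- FEW LETTER SETS: `≤ L` sets of `≤ 2m` letters such that every weight's record letters lie in one of them. -/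
def FewLetterSets (γ γ' : Fin m → Fin n → ℂ[X]) (x : Fin n → Expo) (d : Fin 2 → ℤ) (m' L : ℕ) : Prop :=
  ∃ 𝒩 : Finset (Finset (Fin n)), 𝒩.card ≤ L ∧ (∀ N ∈ 𝒩, N.card ≤ 2 * m) ∧
    ∀ ξ : Fin 2 → ℝ, ∃ N ∈ 𝒩, recordLettersAt γ γ' x d m' ξ ⊆ N

/-- Reduction: few letter sets ⇒ few records (`k ∈ {kmax, kmin}` per `S`). -/
theorem count_of_fewLetterSets (m n D L : ℕ) (γ γ' : Fin m → Fin n → ℂ[X]) (hγD : DegLe γ D) (hγ'D : DegLe γ' D)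
    (x : Fin n → Expo) (d : Fin 2 → ℤ) (h : FewLetterSets γ γ' x d m L) :
    ((shallowPairsT n m D).filter fun p => ∃ ξ : Fin 2 → ℝ, IsRecordT γ γ' x d m ξ p).card
      ≤ L * (2 * ((m + 1) * 2 ^ (2 * m + m))) := by
  obtain ⟨𝒩, hcard, hsize, hcover⟩ := h
  calc _ ≤ (𝒩.biUnion fun N => candidatesT γ γ' D m N).card := Finset.card_le_card ?_
    _ ≤ ∑ N ∈ 𝒩, (candidatesT γ γ' D m N).card := Finset.card_biUnion_le
    _ ≤ ∑ _N ∈ 𝒩, 2 * ((m + 1) * 2 ^ (2 * m + m)) :=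
        Finset.sum_le_sum fun N hN => card_candidatesT_le γ γ' D m (2 * m) _ (hsize N hN)
    _ = 𝒩.card * (2 * ((m + 1) * 2 ^ (2 * m + m))) := by rw [Finset.sum_const, smul_eq_mul]
    _ ≤ L * (2 * ((m + 1) * 2 ^ (2 * m + m))) := Nat.mul_le_mul_right _ hcard
  rintro ⟨S, k⟩ hp
  rw [Finset.mem_filter] at hp
  obtain ⟨-, ξ, hrec⟩ := hp
  obtain ⟨N, hN, hsub⟩ := hcover ξ
  rw [Finset.mem_biUnion]
  refine ⟨N, hN, ?_⟩
  have hlive := hrec.1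
  simp only [liveT, Set.mem_setOf_eq] at hlive
  obtain ⟨hsizeS, -⟩ := hlive
  have hS : S ∈ msets N m :=
    mem_msets hsizeS fun a ha => hsub (by
      simp only [recordLettersAt, Finset.mem_filter, Finset.mem_univ, true_and]
      exact ⟨S, k, hrec, Nat.pos_of_ne_zero ha⟩)
  rcases record_k γ γ' D hγD hγ'D x d m ξ S k hrec with h | h
  · exact Finset.mem_union_left _ (Finset.mem_image.mpr ⟨S, hS, by rw [h]⟩)
  · exact Finset.mem_union_right _ (Finset.mem_image.mpr ⟨S, hS, by rw [h]⟩)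

/-- **VERTEX WALK BOUND** (typed target; PAPER proof in the memo — valuated-matroid shadow + Brualdi exchange bijection + rank
potential; NOT yet kernel): the sweep `ξ ↦ β*(ξ)` meets at most `4mn + 4` optimal column sets. -/
def VertexWalkBound : Prop :=
  ∀ (m n : ℕ) (γ γ' : Fin m → Fin n → ℂ[X]) (x : Fin n → Expo) (d : Fin 2 → ℤ), FewLetterSets γ γ' x d m (4 * m * n + 4)

/-- **LEVEL-FREE RECORD LAW** (crit-8's Q-R13, coefficient side): ARBITRARY pencils, bound independent of degrees and levels. -/
def LevelFreeRecordLaw : Prop :=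
  ∃ a b : ℕ, ∀ (m n t D : ℕ) (γ γ' : Fin m → Fin n → ℂ[X]) (x : Fin n → Expo) (d : Fin 2 → ℤ),
    DegLe γ D → DegLe γ' D → n ≤ 2 * m * t →
    ((shallowPairsT n m D).filter fun p => ∃ ξ : Fin 2 → ℝ, IsRecordT γ γ' x d m ξ p).card
      ≤ 2 ^ (a * m) * (t + 2) ^ b

/-- Arithmetic: `(4mn+4)·2(m+1)2^{3m} ≤ 2^{11 m}(t+2)` for `n ≤ 2mt`. [folklore] -/
theorem arith_levelFree (m n t : ℕ) (hm : 1 ≤ m) (hn : n ≤ 2 * m * t) :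
    (4 * m * n + 4) * (2 * ((m + 1) * 2 ^ (2 * m + m))) ≤ 2 ^ (11 * m) * (t + 2) ^ 1 := by
  obtain ⟨X, hX⟩ : ∃ X : ℕ, X = 2 ^ m := ⟨_, rfl⟩
  have hmX : m + 1 ≤ X := hX ▸ Nat.lt_two_pow_self
  have hX2 : 2 ≤ X := by
    rw [hX]
    calc (2 : ℕ) = 2 ^ 1 := (pow_one 2).symm
      _ ≤ 2 ^ m := Nat.pow_le_pow_right (by norm_num) hm
  have h3 : 2 ^ (2 * m + m) = X ^ 3 := by
    rw [hX, ← pow_mul]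
    ring_nf
  have h11 : 2 ^ (11 * m) = X ^ 11 := by rw [hX, ← pow_mul, mul_comm]
  rw [h3, h11, pow_one]
  have hA : 4 * m * n + 4 ≤ 12 * (X ^ 2 * (t + 2)) := by
    have h1 : 4 * m * n ≤ 8 * (m * m) * t := by
      calc 4 * m * n ≤ 4 * m * (2 * m * t) := Nat.mul_le_mul_left _ hn
        _ = 8 * (m * m) * t := by ring
    have h2 : m * m ≤ X ^ 2 := by
      calc m * m ≤ X * X := Nat.mul_le_mul (by omega) (by omega)
        _ = X ^ 2 := (sq X).symm
    have h3 : 8 * (m * m) * t ≤ 8 * X ^ 2 * (t + 2) := Nat.mul_le_mul (Nat.mul_le_mul_left 8 h2) (by omega)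
    have h4 : 1 ≤ X ^ 2 * (t + 2) := Nat.one_le_iff_ne_zero.mpr (by positivity)
    nlinarith
  have hC : 2 * ((m + 1) * X ^ 3) ≤ 2 * (X * X ^ 3) := Nat.mul_le_mul_left 2 (Nat.mul_le_mul_right _ hmX)
  have h24 : 24 ≤ X ^ 5 :=
    calc (24 : ℕ) ≤ 2 ^ 5 := by norm_num
      _ ≤ X ^ 5 := Nat.pow_le_pow_left hX2 5
  calc (4 * m * n + 4) * (2 * ((m + 1) * X ^ 3)) ≤ 12 * (X ^ 2 * (t + 2)) * (2 * (X * X ^ 3)) := Nat.mul_le_mul hA hC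
    _ = 24 * (X ^ 6 * (t + 2)) := by ring
    _ ≤ X ^ 5 * (X ^ 6 * (t + 2)) := Nat.mul_le_mul_right _ h24
    _ = X ^ 11 * (t + 2) := by ring

/-- **REDUCTION, PROVED**: the vertex walk bound implies the level-free record law with `(a, b) = (11, 1)` — LINEAR in `t`. -/
theorem levelFree_of_vertexWalk (hV : VertexWalkBound) : LevelFreeRecordLaw := by
  refine ⟨11, 1, fun m n t D γ γ' x d hγD hγ'D hn => ?_⟩
  rcases Nat.eq_zero_or_pos m with rfl | hm
  · have h0 : ((shallowPairsT n 0 D).filter fun p => ∃ ξ : Fin 2 → ℝ, IsRecordT γ γ' x d 0 ξ p).card = 0 := by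
      rw [Finset.card_eq_zero, Finset.filter_eq_empty_iff]
      rintro p - ⟨ξ, hrec⟩
      have h := hrec.1
      simp only [liveT, Set.mem_setOf_eq, layerT, momentPolyT] at h
      exact h.2 (by simp)
    rw [h0]
    exact Nat.zero_le _
  exact (count_of_fewLetterSets m n D _ γ γ' hγD hγ'D x d (hV m n γ γ' x d)).trans (arith_levelFree m n t hm hn)

/-! ## 11b. Class-side typed targets added at transplant (val-lit-p3 g18; proved in `…TowerRecordLevelFreeCarrier` by the degree-`D` Lift) -/

/-- **LEVEL-FREE CARRIER LAW** (class side of `LevelFreeRecordLaw`): instances whose tail alphabet lies in ANY tower `X ⊔ (X+d) ⊔ … ⊔ (X+D•d)`,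
tower-dissociated to depth `(m, D)`, obey the per-cell law `≤ 2^{a m}(t+2)^b` with absolute `a, b` — the height `D` and the number of levels do
NOT enter the bound («level-free» refers to the BOUND; the hypothesis still depends on `D` through the dissociation box `TowerDissociated … D`
(margin `D·d`), so the law is uniform in the number of levels USED, not in the geometry allowed).  Proved in `…TowerRecordLevelFreeCarrier`
(`levelFreeCarrierLaw_holds`, via the kernel theorem `levelFreeRecordLaw_holds` of val-idea-37 g4 and the degree-`D` Lift).  HONEST LABEL: even proved it would be a
CLASS rung (parallel towers on tower-dissociated carriers), inert as a hatch; the collinear digit towers of F10 (fibre lumping) are NOT covered;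
not `PlanarCellBound`, not the crux; VP ≠ VNP is NOT proved. -/
def LevelFreeCarrierLaw : Prop :=
  ∃ a b : ℕ, ∀ (m t n D : ℕ) (u v : Fin m → MvPolynomial (Fin 2) ℂ) (x : Fin n → Expo) (d : Fin 2 → ℤ),
    2 ≤ t →
    (∀ j, MvPolynomial.coeff 0 (u j) = 0 ∧ (u j).support.card ≤ t) →
    (∀ j, MvPolynomial.coeff 0 (v j) = 0 ∧ (v j).support.card ≤ t) →
    (∀ e ∈ tailSupport u v, ∃ i : Fin n, ∃ j : ℕ, j ≤ D ∧ ∀ c, ((e c : ℕ) : ℤ) = ((x i c : ℕ) : ℤ) + (j : ℤ) * d c) →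
    TowerDissociated x d m D →
    ∀ (R : Expo → Expo → Prop) (S : Finset Expo), IsCellFamily u v R S → S.card ≤ 2 ^ (a * m) * (t + 2) ^ b

/-- (A_free) ⇒ (B_free): the degree-`D` Lift with `E = [0, D]` (typed target; proved in `…TowerRecordLevelFreeCarrier`). -/
def levelFreeCarrier_of_levelFreeRecord : Prop := LevelFreeRecordLaw → LevelFreeCarrierLaw

end Cramer


end Summit.ValiantsHypothesis.ValiantsHypothesis.Theorems.NewtonUnitEquations.TwoProducts.TowerRecord

end
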